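import Summits.SmoothPoincare4.SmoothPoincare4.Theorems.EntropyRungBakryEmeryLogSobolevForcing
import HarnessLib

/-!
# The linear Cauchy problem for the ground-state transformed heat operator with compactly supported
# datum on a complete weighted manifold with ARBITRARY smooth weight
# (support item `EntropyRung.BakryEmeryLogSobolev`, stmt-SmoothPoincare4-16587)

`linearHeat_cauchy_gaffney`: the shrinker toolkit's `helper_linearHeat_noncompact`
(`EntropyRungNoncompactShrinkerGapHeatLinearHeat.lean`, crux `EntropyRung.NoncompactShrinkerGap`; Trèves
1975, §41) for the potential `Q = ¼|∇V|² − ½Δ_gV + 1` of an ARBITRARY smooth weight `e^{-V}` (no lower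
bound) and first-order (Gaffney) cut-offs: given flat-corrector data `(W, G, K)` (`W`, `G` smooth on
`M × ℝ`, vanishing off the compact `K` and for `s ≥ 1`, `G = 0` for `s ≤ 0`, `G = −(∂ₛW − ΔW + QW)` for
`s ≥ 0`, as produced by `helper_flatCorrector_noncompact`), for every `T > 0` there is `w` smooth on
`M × (−∞, T + 1)` with `w(0) = W(0)`, `∂ₛw = Δ_g w − Qw` on `[0, T]`, and `w ∈ L²(M × (0, T))`
(`w = W + v` with the forced solution `v` of `exists_smooth_schrodingerHeat_forcing`). The proof is the
toolkit's, with that one call replaced. Everything is proved; no definitions, no named facts.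

## References

* [Treves1975] F. Trèves, *Basic Linear Partial Differential Equations* (1975), §41, Thm. 40.1.
* [Grigoryan2009] A. Grigor'yan (2009), Ch. 8.
-/

noncomputable section

set_option linter.dupNamespace false

open scoped Manifold ContDiff ENNReal NNReal Topology
open MeasureTheory Set Filter
open Literature.Geometry.Lorentzian Literature.Geometry.Riemannian
open Literature.Geometry.Lorentzian.PseudoRiemannianMetric (laplaceBeltrami_eq_dalembertian)

namespace Summit.SmoothPoincare4.SmoothPoincare4.Theorems.BakryEmeryComplete

open NoncompactShrinkerGapHeat

section Cauchy

variable {n : ℕ} {M : Type*} [TopologicalSpace M] [T2Space M] [SecondCountableTopology M]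
  [ChartedSpace (EuclideanSpace ℝ (Fin n)) M] [IsManifold (𝓡 n) ∞ M] [T3Space M] [MeasurableSpace M]
  [BorelSpace M]
  {g : PseudoRiemannianMetric (𝓡 n) ∞ (EuclideanSpace ℝ (Fin n)) (TangentSpace (𝓡 n) : M → Type _)}
  [g.HasLeviCivita]

/-- **The linear Cauchy problem `∂ₛw = Δ_g w − Qw`, `w(0) = W(0)`, `Q = ¼|∇V|² − ½ΔV + 1`, for flat-corrector
data on a complete weighted manifold with arbitrary smooth weight and Gaffney cut-offs** (see the module
docstring). [cite: Treves1975, §41, Thm. 40.1] -/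
theorem linearHeat_cauchy_gaffney (hg : g.IsRiemannian) {V : M → ℝ} (hV : ContMDiff (𝓡 n) 𝓘(ℝ, ℝ) ∞ V)
    {η : ℕ → M → ℝ} {C₀ : ℝ} (hηs : ∀ k, ContMDiff (𝓡 n) 𝓘(ℝ, ℝ) ∞ (η k))
    (hηc : ∀ k, HasCompactSupport (η k)) (hη01 : ∀ k x, 0 ≤ η k x ∧ η k x ≤ 1)
    (hηmono : ∀ k x, η k x ≤ η (k + 1) x) (hη1 : ∀ x, ∀ᶠ k in atTop, η k x = 1)
    (hηgrad : ∀ k x, g.gradSq (η k) x ≤ C₀ / ((k : ℝ) + 1) ^ 2)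
    {W G : ℝ → M → ℝ} {K : Set M} (hK : IsCompact K)
    (hW : ContMDiff ((𝓡 n).prod 𝓘(ℝ, ℝ)) 𝓘(ℝ, ℝ) ∞ (fun p : M × ℝ ↦ W p.2 p.1))
    (hG : ContMDiff ((𝓡 n).prod 𝓘(ℝ, ℝ)) 𝓘(ℝ, ℝ) ∞ (fun p : M × ℝ ↦ G p.2 p.1))
    (hWK : ∀ s x, x ∉ K → W s x = 0) (hGK : ∀ s x, x ∉ K → G s x = 0)
    (hWG1 : ∀ s, 1 ≤ s → ∀ x, W s x = 0 ∧ G s x = 0) (hG0 : ∀ s ≤ 0, ∀ x, G s x = 0)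
    (hGW : ∀ s, 0 ≤ s → ∀ x, G s x = -(deriv (fun r ↦ W r x) s
      - (g.laplaceBeltrami (W s) x - (g.gradSq V x / 4 - g.dalembertian V x / 2 + 1) * W s x)))
    {T : ℝ} (hT : 0 < T) :
    ∃ (O : Set ℝ) (w : ℝ → M → ℝ), IsOpen O ∧ Icc 0 T ⊆ O ∧
      ContMDiffOn ((𝓡 n).prod 𝓘(ℝ, ℝ)) 𝓘(ℝ, ℝ) ∞ (fun p : M × ℝ ↦ w p.2 p.1) (univ ×ˢ O) ∧
      (∀ x, w 0 x = W 0 x) ∧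
      (∀ s ∈ Icc 0 T, ∀ x, deriv (fun r ↦ w r x) s =
        g.dalembertian (w s) x - (g.gradSq V x / 4 - g.dalembertian V x / 2 + 1) * w s x) ∧
      Integrable (fun p : M × ℝ ↦ w p.2 p.1 ^ 2)
        ((g.riemVolume.prod (volume : Measure ℝ)).restrict (univ ×ˢ Ioo 0 T)) := by
  classical
  haveI : LocallyCompactSpace M := ChartedSpace.locallyCompactSpace (EuclideanSpace ℝ (Fin n)) M
  haveI := CarrilloNi2009_shrinkerLSI.isFiniteMeasureOnCompacts_riemVolume hg
  haveI : SigmaFinite g.riemVolume := CutoffToolkit.sigmaFinite_riemVolume hg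
  -- `G` has compact support in `K × [0, 1]`
  have hGc : HasCompactSupport (fun p : M × ℝ ↦ G p.2 p.1) := by
    refine HasCompactSupport.intro (hK.prod (isCompact_Icc (a := (0 : ℝ)) (b := 1))) ?_
    rintro ⟨x, s⟩ hp
    simp only [mem_prod, mem_Icc, not_and_or, not_le] at hp
    rcases hp with hx | hs | hs
    · exact hGK s x hx
    · exact hG0 s hs.le x
    · exact (hWG1 s hs.le x).2
  set b : ℝ := T + 1 with hbdef
  have hb : 0 < b := by rw [hbdef]; linarith
  obtain ⟨v, hv, hv0, hveq, hvL2⟩ := exists_smooth_schrodingerHeat_forcing hg hV hηs hηc hη01 hηmono hη1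
    hηgrad hG hGc hG0 hb
  -- the solution `w = W + v`
  set w : ℝ → M → ℝ := fun s x ↦ W s x + v (x, s) with hwdef
  have hws : ContMDiffOn ((𝓡 n).prod 𝓘(ℝ, ℝ)) 𝓘(ℝ, ℝ) ∞ (fun p : M × ℝ ↦ w p.2 p.1) (univ ×ˢ Iio b) :=
    hW.contMDiffOn.add hv
  refine ⟨Iio b, w, isOpen_Iio, fun s hs ↦ by simp only [mem_Iio, hbdef]; linarith [hs.2], hws, fun x ↦ ?_,
    fun s hs x ↦ ?_, ?_⟩
  · simp [hwdef, hv0 x 0 le_rfl]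
  · -- the equation on `[0, T]`
    have hsb : s < b := by rw [hbdef]; linarith [hs.2]
    have hdW : HasDerivAt (fun r ↦ W r x) (deriv (fun r ↦ W r x) s) s :=
      ((contDiff_time_slice hW x).differentiable (by simp)).differentiableAt.hasDerivAt
    have hdv : HasDerivAt (fun r ↦ v (x, r)) (deriv (fun r ↦ v (x, r)) s) s :=
      hasDerivAt_slice_of_contMDiffOn isOpen_Iio hv x hsb
    have hd : deriv (fun r ↦ w r x) s = deriv (fun r ↦ W r x) s + deriv (fun r ↦ v (x, r)) s :=
      (hdW.add hdv).deriv
    have h2 : (2 : ℕ∞ω) ≤ (∞ : ℕ∞ω) := by norm_cast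
    have hWs2 : ContMDiffAt (𝓡 n) 𝓘(ℝ, ℝ) 2 (W s) x :=
      ((contMDiff_space_slice hW s).of_le h2).contMDiffAt
    have hvs2 : ContMDiffAt (𝓡 n) 𝓘(ℝ, ℝ) 2 (fun y ↦ v (y, s)) x := by
      have hO : IsOpen ((univ : Set M) ×ˢ Iio b) := isOpen_univ.prod isOpen_Iio
      have h1 : ContMDiffOn (𝓡 n) 𝓘(ℝ, ℝ) ∞ (fun y ↦ v (y, s)) univ := fun y _ ↦
        (hv.comp_contMDiff (f := fun y : M ↦ ((y, s) : M × ℝ)) (contMDiff_id.prodMk contMDiff_const)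
          (fun y ↦ ⟨mem_univ _, hsb⟩)).contMDiffAt.contMDiffWithinAt
      exact ((contMDiffOn_univ.1 h1).of_le h2).contMDiffAt
    have hΔ : g.dalembertian (w s) x = g.dalembertian (W s) x + g.dalembertian (fun y ↦ v (y, s)) x := by
      have := g.dalembertian_add_of_contMDiffAt hWs2 hvs2
      simpa [hwdef, Pi.add_def] using this
    have hGW' := hGW s hs.1 x
    have hveq' := hveq x s hsb
    rw [laplaceBeltrami_eq_dalembertian] at hGW' hveq'
    simp only [hwdef]
    rw [hd, hΔ]
    linarith
  · -- `w² ∈ L¹(M × (0, T))`: `W` is bounded with compact spatial support, `v ∈ L²`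
    have hmeasS : MeasurableSet ((univ : Set M) ×ˢ Ioo (0 : ℝ) T) := MeasurableSet.univ.prod measurableSet_Ioo
    have hvT : Integrable (fun p : M × ℝ ↦ v p ^ 2)
        ((g.riemVolume.prod (volume : Measure ℝ)).restrict (univ ×ˢ Ioo 0 T)) := by
      refine hvL2.mono_measure (Measure.restrict_mono (Set.prod_mono le_rfl (Ioo_subset_Ioo le_rfl ?_)) le_rfl)
      rw [hbdef]; linarith
    obtain ⟨B, hB⟩ := (hK.prod (isCompact_Icc (a := (0 : ℝ)) (b := T))).exists_bound_of_continuousOn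
      (f := fun p : M × ℝ ↦ W p.2 p.1) hW.continuous.continuousOn
    have hWbd : ∀ p ∈ (univ : Set M) ×ˢ Ioo (0 : ℝ) T,
        ‖W p.2 p.1‖ ≤ (K ×ˢ (univ : Set ℝ)).indicator (fun _ ↦ max B 0) p := by
      rintro ⟨x, s⟩ ⟨-, hs⟩
      by_cases hx : x ∈ K
      · rw [indicator_of_mem (show ((x, s) : M × ℝ) ∈ K ×ˢ (univ : Set ℝ) from ⟨hx, mem_univ _⟩)]
        exact (hB (x, s) ⟨hx, Ioo_subset_Icc_self hs⟩).trans (le_max_left _ _)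
      · rw [indicator_of_notMem (show ((x, s) : M × ℝ) ∉ K ×ˢ (univ : Set ℝ) from fun h ↦ hx h.1)]
        simp [hWK s x hx]
    set ν : Measure (M × ℝ) := (g.riemVolume.prod (volume : Measure ℝ)).restrict (univ ×ˢ Ioo 0 T) with hν
    have hKfin : ν (K ×ˢ (univ : Set ℝ)) ≠ (⊤ : ℝ≥0∞) := by
      rw [hν, Measure.restrict_apply (hK.measurableSet.prod MeasurableSet.univ)]
      have h1 : K ×ˢ (univ : Set ℝ) ∩ (univ : Set M) ×ˢ Ioo (0 : ℝ) T = K ×ˢ Ioo (0 : ℝ) T := by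
        ext ⟨x, s⟩; simp [mem_prod]
      rw [h1, Measure.prod_prod]
      exact (ENNReal.mul_lt_top (hK.measure_lt_top) measure_Ioo_lt_top).ne
    have hdom : Integrable (fun p : M × ℝ ↦ ((K ×ˢ (univ : Set ℝ)).indicator (fun _ ↦ max B 0) p) ^ 2 +
        v p ^ 2 + 2 * (((K ×ˢ (univ : Set ℝ)).indicator (fun _ ↦ max B 0) p) * |v p|)) ν := by
      have hI : Integrable (fun p : M × ℝ ↦ (K ×ˢ (univ : Set ℝ)).indicator (fun _ ↦ max B 0) p) ν :=
        (integrableOn_const (C := max B 0) hKfin).integrable_indicator (hK.measurableSet.prod MeasurableSet.univ)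
      have hI2 : Integrable (fun p : M × ℝ ↦ ((K ×ˢ (univ : Set ℝ)).indicator (fun _ ↦ max B 0) p) ^ 2) ν := by
        have : (fun p : M × ℝ ↦ ((K ×ˢ (univ : Set ℝ)).indicator (fun _ ↦ max B 0) p) ^ 2) =
            (K ×ˢ (univ : Set ℝ)).indicator (fun _ ↦ (max B 0) ^ 2) := by
          funext p
          by_cases hp : p ∈ K ×ˢ (univ : Set ℝ)
          · simp [indicator_of_mem hp]
          · simp [indicator_of_notMem hp]
        rw [this]
        exact (integrableOn_const (C := (max B 0) ^ 2) hKfin).integrable_indicator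
          (hK.measurableSet.prod MeasurableSet.univ)
      -- `indicator * |v|` is dominated by `indicator² + v²` up to the factor 1/2; use `2ab ≤ a² + b²`
      have hIv : Integrable (fun p : M × ℝ ↦ ((K ×ˢ (univ : Set ℝ)).indicator (fun _ ↦ max B 0) p) * |v p|) ν := by
        refine (hI2.add hvT).mono' ?_ (Eventually.of_forall fun p ↦ ?_)
        · refine (hI.aestronglyMeasurable.mul ?_)
          have hvc : ContinuousOn v ((univ : Set M) ×ˢ Ioo (0 : ℝ) T) :=
            hv.continuousOn.mono (Set.prod_mono le_rfl fun s hs ↦ by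
              simp only [mem_Iio, hbdef]; linarith [hs.2])
          exact (hvc.aestronglyMeasurable hmeasS).norm.congr (Eventually.of_forall fun p ↦ by
            simp [Real.norm_eq_abs])
        · show ‖(K ×ˢ (univ : Set ℝ)).indicator (fun _ ↦ max B 0) p * |v p|‖ ≤
            ((K ×ˢ (univ : Set ℝ)).indicator (fun _ ↦ max B 0) p) ^ 2 + v p ^ 2
          rw [Real.norm_eq_abs, abs_mul, abs_abs]
          have ha : 0 ≤ (K ×ˢ (univ : Set ℝ)).indicator (fun _ ↦ max B 0) p := by
            by_cases hp : p ∈ K ×ˢ (univ : Set ℝ)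
            · simp [indicator_of_mem hp]
            · simp [indicator_of_notMem hp]
          rw [abs_of_nonneg ha]
          nlinarith [sq_nonneg ((K ×ˢ (univ : Set ℝ)).indicator (fun _ ↦ max B 0) p - |v p|), sq_abs (v p)]
      exact (hI2.add hvT).add (hIv.const_mul 2)
    refine hdom.mono' ?_ ?_
    · have hwc : ContinuousOn (fun p : M × ℝ ↦ w p.2 p.1 ^ 2) ((univ : Set M) ×ˢ Ioo (0 : ℝ) T) :=
        (hws.continuousOn.mono (Set.prod_mono le_rfl fun s hs ↦ by
          simp only [mem_Iio, hbdef]; linarith [hs.2])).pow 2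
      exact hwc.aestronglyMeasurable hmeasS
    · rw [hν, ae_restrict_iff' hmeasS]
      refine Eventually.of_forall fun p hp ↦ ?_
      have h1 := hWbd p hp
      rw [Real.norm_eq_abs] at h1
      rw [Real.norm_eq_abs, abs_pow, hwdef]
      simp only
      have h2 : |W p.2 p.1 + v (p.1, p.2)| ≤ |W p.2 p.1| + |v p| := by
        simpa using abs_add_le (W p.2 p.1) (v (p.1, p.2))
      have h3 : 0 ≤ |W p.2 p.1| := abs_nonneg _
      have h4 : 0 ≤ |v p| := abs_nonneg _
      calc |W p.2 p.1 + v (p.1, p.2)| ^ 2 ≤ (|W p.2 p.1| + |v p|) ^ 2 :=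
            pow_le_pow_left₀ (abs_nonneg _) h2 2
        _ ≤ ((K ×ˢ (univ : Set ℝ)).indicator (fun _ ↦ max B 0) p + |v p|) ^ 2 := by
            apply pow_le_pow_left₀ (by positivity)
            linarith
        _ = ((K ×ˢ (univ : Set ℝ)).indicator (fun _ ↦ max B 0) p) ^ 2 + v p ^ 2 +
              2 * (((K ×ˢ (univ : Set ℝ)).indicator (fun _ ↦ max B 0) p) * |v p|) := by
            rw [add_sq, sq_abs]; ring


end Cauchy

end Summit.SmoothPoincare4.SmoothPoincare4.Theorems.BakryEmeryComplete

end
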